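import Literature.AlgebraicGeometry.HodgeTheory.PolarizedLimitMixedHodgeStructurePeriodMapNormalForm
import HarnessLib

/-!
# Cattani–Deligne–Kaplan, Theorem 2.16, for a one-variable period map in asymptotic normal form `Φ(z) = exp(zN)·G(z)·F`:
# integral classes of bounded Hodge norm exponentially close to `F^pΦ(z)` in the Hodge metric OF `Φ(z)` near the puncture

Topic `Literature/AlgebraicGeometry/HodgeTheory` (namespace `…HodgeTheory.PolarizedLimitMixedHodgeStructure`).  Theorems only; no
definition, no instance, no named fact (D-0026 net debt `0`).  The sequel of `…PeriodMapNormalForm` (which proves Thm. 2.5 for such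
period maps — EXACT Hodge classes of `Φ(z)`) and of `…ApproximateIntegralHodgeClasses` (Thm. 2.16 for the nilpotent orbit): here the
classes are only close to `F^pΦ(z)`, with norms and angles measured in the Hodge metric of the point `Φ(z) ∈ D` itself, as printed.

PRINTED SOURCE, VERBATIM. E. Cattani, P. Deligne, A. Kaplan, *On the locus of Hodge classes*, J. Amer. Math. Soc. 8 (1995) 483–506,
p. 492: **Theorem 2.16.** «Assume `𝒱` of weight `0`. Given `K` and `α > 0`, there is a constant `A₁` (depending on `K`, `α`, and `𝒱`)
such that (i) There are only finitely many elements `v ∈ V_ℤ` such that, at some point `z` with `0 ≤ x_j ≤ 1` and `inf(y_j) ≥ A₁`,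
`‖v‖_{Φ(z)} ≤ K` and, relative to the Hodge metric at `Φ(z)`, (2.16.1) `v ∼_z Φ⁰(z)`. (ii) Any such `v` is in `W₀`. (iii) If a fixed `v`
satisfies (i) at a sequence of points … then `v` is in `F⁰` for some limiting Hodge filtration `F`.»  **2.18** (p. 492): «To prove 2.16,
one would like to be able to replace `Φ` by `Φ_nil`. For `inf(y_j)` large, `Φ(z)` and `Φ_nil(z)` are close — roughly at a distance
`exp(−2π inf(y_j))`.»  **4.2** (p. 500): «By 2.3 … we still have `u(n)` bounded in the `Φ′`-Hodge norm at `z(n)`, and `∼_{z(n)} Φ′⁰(z(n))`.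
The monodromies, as well as the limiting Hodge filtrations, being the same for `Φ` and `Φ′`, we may replace `Φ` by `Φ′`: we may and shall
assume that `Φ` is a nilpotent orbit.»

THE HYPOTHESES (as in `…PeriodMapNormalForm`): `L = (W, F, N, Q)` a polarized limit mixed Hodge structure of weight `k = p + p`, nilpotent
orbit `θ(z)` (`Im z > β`); `G : ℂ → End(V_ℂ)` with `|G(z)w − w|₀ ≤ C e^{−γ Im z}|w|₀` (`Im z ≥ A₀`, `γ > 0`) and `G(z) ∈ Aut(Q_ℂ)`;
`Φ^q(z) = exp(zN)·G(z)·F^q`.  "The Hodge metric at `Φ(z)`" is that of ANY polarized Hodge structure `(H', P')` of weight `k` with Hodge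
filtration `Φ(z)` and form `Q` (they exist for `Im z ≫ 0`, `exists_forall_exists_hodgeStructure_polarization_periodMap`; the Hodge norm
depends only on the flag and the form, `Polarization.hodgeNorm_congr`).

WHAT IS FORMALIZED.
* §1 «`Φ(z)` and `Φ_nil(z)` are close»: the two Hodge metrics are uniformly comparable, **`(1 − c η(z))‖x‖_{θ(z)} ≤ ‖x‖_{Φ(z)} ≤
  (1 + c η(z))‖x‖_{θ(z)}`**, `η(z) = D (Im z)^m e^{−γ Im z}` (`exists_forall_hodgeNorm_periodMap_mem_Icc`; the tree's continuity of the
  Hodge metric, `Motives/HodgeStructureHodgeMetricContinuity`), hence within the factor `2` for `Im z ≫ 0`.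
* §2 «we may replace `Φ` by `Φ′ = Φ_nil`» (4.2 at `d = 1`): if `‖v‖_{Φ(z)} ≤ K` and `v ∼_{α,z} F^pΦ(z)` in the Hodge metric of `Φ(z)`, then
  `‖v‖_{θ(z)} ≤ 2K` and **`v ∼_{α',z} F^pθ(z)` in the Hodge metric of `θ(z)`** with `α' = min(α, γ)/2`, for `Im z ≥ A`
  (`exists_forall_transfer_to_nilpotentOrbit`).
* §3 **CDK THEOREM 2.16 FOR THE PERIOD MAP `Φ`, `r = 1`** (`exists_threshold_approximate_integral_hodgeClasses_periodMap`): there is `A₁`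
  such that for every `u ∈ Λ` and every point `z` (`Im z ≥ A₁`, `|Re z| ≤ R`) and every polarized Hodge structure `(H', P')` on the flag
  `Φ(z)` with form `Q`: `‖1 ⊗ u‖_{Φ(z)} ≤ K` and `∃ f ∈ F^pΦ(z)`, `‖1 ⊗ u − f‖_{Φ(z)} ≤ e^{−α Im z}‖1 ⊗ u‖_{Φ(z)}` imply **(ii) `u ∈ W_k`, (4.1.4)
  `N u = 0`, (iii) `1 ⊗ u ∈ F^p` (the limiting Hodge filtration) and `u ∈ H^{p,p}(θ(z'))` at every point of the nilpotent orbit; (i) these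
  `u` are FINITE in number.**

NOT HERE: several variables; the algebraicity statements 1.1–1.5; Schmid's nilpotent orbit theorem (the normal form is a hypothesis).

## References

* [CattaniDeligneKaplan1995] E. Cattani, P. Deligne, A. Kaplan, *On the locus of Hodge classes*, J. Amer. Math. Soc. 8 (1995)
  483–506: Thm. 2.16, 2.17, 2.18 (p. 492), 2.3 (p. 487), 4.2 (p. 500).
* [CarlsonMullerStachPeters2017] J. Carlson, S. Müller-Stach, C. Peters, *Period Mappings and Period Domains* (2nd ed. 2017): §2.3
  Thm. 2.3.3, Prop. 4.4.2.
* [Schmid1973] W. Schmid, Invent. Math. 22 (1973): (4.12), Thm. (6.6) (cite only).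
-/

noncomputable section

open scoped TensorProduct ComplexOrder
open Filter Topology

namespace Literature.AlgebraicGeometry

open Module
open Motives Motives.MixedHodgeStructure Motives.HodgeStructure
open Motives.HodgeStructure (conj ofRat ofRat_apply conj_ofRat)

universe u

variable {V : Type u} [AddCommGroup V] [Module ℚ V] [FiniteDimensional ℚ V] {k : ℤ}

namespace HodgeTheory

namespace PolarizedLimitMixedHodgeStructure

variable (L : PolarizedLimitMixedHodgeStructure V k)

/-! ## §0 Tools -/

/-- `y ↦ y^n e^{−αy}` tends to `0` at `+∞` (`α > 0`). [folklore] -/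
private theorem tendsto_pow_mul_exp_neg_mul'' {α : ℝ} (hα : 0 < α) (n : ℕ) :
    Tendsto (fun y : ℝ => y ^ n * Real.exp (-α * y)) atTop (𝓝 0) := by
  have h := ((Real.tendsto_pow_mul_exp_neg_atTop_nhds_zero n).comp (tendsto_id.const_mul_atTop hα)).const_mul ((α ^ n)⁻¹)
  rw [mul_zero] at h
  refine h.congr fun y => ?_
  simp only [Function.comp_apply, id_eq, mul_pow]
  field_simp

/-- An explicit threshold: `y^n e^{−αy} ≤ ε` for `y ≥ A`. [folklore] -/
private theorem exists_forall_pow_mul_exp_le'' {α : ℝ} (hα : 0 < α) (n : ℕ) {ε : ℝ} (hε : 0 < ε) :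
    ∃ A : ℝ, ∀ y : ℝ, A ≤ y → y ^ n * Real.exp (-α * y) ≤ ε := by
  have h := (tendsto_pow_mul_exp_neg_mul'' hα n).eventually (Iic_mem_nhds hε)
  obtain ⟨A, hA⟩ := eventually_atTop.1 h
  exact ⟨A, fun y hy => hA y hy⟩

/-- `y^n e^{−βy} ≤ ε e^{−α'y}` for `y ≥ A` when `α' < β` (split `e^{−βy} = e^{−(β−α')y} e^{−α'y}`). [folklore] -/
private theorem exists_forall_pow_mul_exp_le_mul_exp {β α' : ℝ} (h : α' < β) (n : ℕ) {ε : ℝ} (hε : 0 < ε) :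
    ∃ A : ℝ, ∀ y : ℝ, A ≤ y → y ^ n * Real.exp (-β * y) ≤ ε * Real.exp (-α' * y) := by
  obtain ⟨A, hA⟩ := exists_forall_pow_mul_exp_le'' (sub_pos.2 h) n hε
  refine ⟨A, fun y hy => ?_⟩
  have hsplit : Real.exp (-β * y) = Real.exp (-(β - α') * y) * Real.exp (-α' * y) := by rw [← Real.exp_add]; ring_nf
  rw [hsplit, ← mul_assoc]
  exact mul_le_mul_of_nonneg_right (hA y hy) (Real.exp_pos _).le

/-- The window of the Hodge filtration of the orbit: `θ(z)^a = ⊤`, `θ(z)^b = ⊥` for the indices of the limit filtration. [folklore] -/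
private theorem nilpotentOrbit_F_eq_top_of_F_eq_top {z : ℂ} (hz : L.orbitThreshold < z.im) {a : ℤ} (ha : L.F a = ⊤) :
    (L.nilpotentOrbit z hz).F a = ⊤ := by
  rw [L.nilpotentOrbit_F, ha, Submodule.map_top, LinearMap.range_eq_top]
  exact ((Module.End.isUnit_iff _).1 (IsNilpotent.isUnit_exp (L.isNilpotent_N_baseChange.smul z))).2

/-- `θ(z)^b = ⊥` when `F^b = ⊥`. [folklore] -/
private theorem nilpotentOrbit_F_eq_bot_of_F_eq_bot {z : ℂ} (hz : L.orbitThreshold < z.im) {b : ℤ} (hb : L.F b = ⊥) :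
    (L.nilpotentOrbit z hz).F b = ⊥ := by
  rw [L.nilpotentOrbit_F, hb, Submodule.map_bot]

/-! ## §1 The Hodge metrics of `Φ(z)` and `θ(z)` are uniformly comparable, with ratio `→ 1` exponentially -/

/-- **`(1 − c·η(z))‖x‖_{θ(z)} ≤ ‖x‖_{Φ(z)} ≤ (1 + c·η(z))‖x‖_{θ(z)}`, `η(z) = D (Im z)^m e^{−γ Im z}`**, for every polarized Hodge structure
`(H', P')` of weight `k` with Hodge filtration `Φ(z) = exp(zN)·G(z)·F` and form `Q`, all `x`, all `z` with `Im z ≥ A`, `|Re z| ≤ R` — «for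
`inf(y_j)` large, `Φ(z)` and `Φ_nil(z)` are close» in the sense of their Hodge metrics (the tree's continuity of the Hodge metric at
`θ(z)`, through the window `[a, b)` of the limit filtration). [cite: CattaniDeligneKaplan1995, 2.18 (p. 492) and 2.3 (2.3.3) (p. 487)]
[cite: CarlsonMullerStachPeters2017, §2.3 Thm. 2.3.3] -/
theorem exists_forall_hodgeNorm_periodMap_mem_Icc (G : ℂ → Module.End ℂ (ℂ ⊗[ℚ] V)) {C γ A₀ : ℝ} (hC : 0 ≤ C) (hγ : 0 < γ)
    (hG : ∀ z : ℂ, A₀ ≤ z.im → ∀ w, L.referenceNorm (G z w - w) ≤ C * Real.exp (-γ * z.im) * L.referenceNorm w)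
    (hGQ : ∀ z x y, L.Q.baseChange ℂ (G z x) (G z y) = L.Q.baseChange ℂ x y) (R : ℝ) :
    ∃ c : ℝ, 0 ≤ c ∧ ∃ D : ℝ, 0 ≤ D ∧ ∃ m : ℕ, ∃ A : ℝ, L.normThreshold < A ∧ ∀ (z : ℂ) (hz : L.normThreshold < z.im), A ≤ z.im → |z.re| ≤ R →
      D * z.im ^ m * Real.exp (-γ * z.im) ≤ 1 / 4 ∧
      ∀ (H' : HodgeStructure V k) (P' : H'.Polarization),
        (∀ q, H'.F q = ((L.F q).map (G z)).map (IsNilpotent.exp (z • L.N.baseChange ℂ))) → P'.form = L.Q → ∀ x : ℂ ⊗[ℚ] V,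
          (1 - c * (D * z.im ^ m * Real.exp (-γ * z.im))) * (L.nilpotentOrbitPolarization z (L.orbitThreshold_lt_im hz)).hodgeNorm x ≤
              P'.hodgeNorm x ∧
            P'.hodgeNorm x ≤
              (1 + c * (D * z.im ^ m * Real.exp (-γ * z.im))) * (L.nilpotentOrbitPolarization z (L.orbitThreshold_lt_im hz)).hodgeNorm x := by
  obtain ⟨D, hD, m, hDm⟩ := L.exists_forall_hodgeNorm_conj_sub_le G hC hG R
  obtain ⟨A₂, hA₂⟩ := exists_forall_pow_mul_exp_le'' hγ m (ε := 1 / (16 * (D + 1))) (by positivity)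
  obtain ⟨a, ha⟩ := L.toMixedHodgeStructure.exists_F_eq_top
  obtain ⟨b, hb⟩ := L.toMixedHodgeStructure.exists_F_eq_bot
  refine ⟨12 * (Finset.Ico a b).card, by positivity, D, hD, m, max (max A₀ A₂) (L.normThreshold + 1),
    lt_of_lt_of_le (lt_add_one _) (le_max_right _ _), fun z hz hAz hRz => ?_⟩
  have hA₀z : A₀ ≤ z.im := ((le_max_left _ _).trans (le_max_left _ _)).trans hAz
  have hA₂z : A₂ ≤ z.im := ((le_max_right _ _).trans (le_max_left _ _)).trans hAz
  have hz0 : 0 < z.im := L.im_pos_of_normThreshold_lt hz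
  set Pz := L.nilpotentOrbitPolarization z (L.orbitThreshold_lt_im hz) with hPz_def
  set g := IsNilpotent.exp (z • L.N.baseChange ℂ) * G z * IsNilpotent.exp (-(z • L.N.baseChange ℂ)) with hg_def
  set η := D * z.im ^ m * Real.exp (-γ * z.im) with hη_def
  have hη0 : 0 ≤ η := by positivity
  have hη16 : η ≤ 1 / 16 := by
    have h := hA₂ z.im hA₂z
    have hq : 0 < D + 1 := by positivity
    calc η = D * (z.im ^ m * Real.exp (-γ * z.im)) := by rw [hη_def]; ring
      _ ≤ D * (1 / (16 * (D + 1))) := mul_le_mul_of_nonneg_left h hD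
      _ = D / (D + 1) / 16 := by field_simp
      _ ≤ 1 / 16 := by have : D / (D + 1) ≤ 1 := (div_le_one hq).2 (by linarith); linarith
  refine ⟨by linarith, fun H' P' hF hform x => ?_⟩
  have hu : ∀ x, Pz.hodgeNorm (g x - x) ≤ η * Pz.hodgeNorm x := fun x => hDm z hz hA₀z hRz x
  have hu₀ : ∀ x, Pz.hodgeNorm (g x - x) ≤ 1 / 16 * Pz.hodgeNorm x := fun x =>
    (hu x).trans (mul_le_mul_of_nonneg_right hη16 (Pz.hodgeNorm_nonneg x))
  have hHR : ∀ q : ℤ, ∀ x ∈ (L.nilpotentOrbit z (L.orbitThreshold_lt_im hz)).F q,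
      ∀ y ∈ (L.nilpotentOrbit z (L.orbitThreshold_lt_im hz)).F (k + 1 - q), Pz.form.baseChange ℂ (g x) (g y) = 0 := by
    intro q x hx y hy
    rw [L.nilpotentOrbitPolarization_form, hg_def, L.Q_baseChange_conj_apply G hGQ, ← L.nilpotentOrbitPolarization_form z (L.orbitThreshold_lt_im hz)]
    exact Pz.form_apply_eq_zero q x hx y hy
  -- the Hodge norm of `(H', P')` is that of the perturbed structure `g·θ(z)`
  have hcongr : ∀ x, P'.hodgeNorm x = (Pz.perturbPolarization g hu₀ hHR).hodgeNorm x := fun x =>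
    P'.hodgeNorm_congr (Pz.perturbPolarization g hu₀ hHR) (fun q => by
      rw [hF q, HodgeStructure.Polarization.perturb_F, L.map_exp_map_eq_map_conj_nilpotentOrbit_F G (L.orbitThreshold_lt_im hz) q])
      (by rw [hform, HodgeStructure.Polarization.perturbPolarization_form, L.nilpotentOrbitPolarization_form]) x
  have haz := L.nilpotentOrbit_F_eq_top_of_F_eq_top (L.orbitThreshold_lt_im hz) ha
  have hbz := L.nilpotentOrbit_F_eq_bot_of_F_eq_bot (L.orbitThreshold_lt_im hz) hb
  refine ⟨?_, ?_⟩
  · rw [hcongr]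
    exact Pz.sub_mul_hodgeNorm_le_hodgeNorm_perturb g hu₀ hHR hu hη0 (by linarith) haz hbz x
  · rw [hcongr]
    exact Pz.hodgeNorm_perturb_le g hu₀ hHR hu hη0 (by linarith) haz hbz x

/-- **The factor-`2` form: `½‖x‖_{θ(z)} ≤ ‖x‖_{Φ(z)} ≤ 2‖x‖_{θ(z)}` for `Im z ≥ A`, `|Re z| ≤ R`**, every `(H', P')` on the flag `Φ(z)` with
form `Q`. [cite: CattaniDeligneKaplan1995, 2.18 (p. 492)] -/
theorem exists_forall_hodgeNorm_periodMap_le_two_mul (G : ℂ → Module.End ℂ (ℂ ⊗[ℚ] V)) {C γ A₀ : ℝ} (hC : 0 ≤ C) (hγ : 0 < γ)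
    (hG : ∀ z : ℂ, A₀ ≤ z.im → ∀ w, L.referenceNorm (G z w - w) ≤ C * Real.exp (-γ * z.im) * L.referenceNorm w)
    (hGQ : ∀ z x y, L.Q.baseChange ℂ (G z x) (G z y) = L.Q.baseChange ℂ x y) (R : ℝ) :
    ∃ A : ℝ, L.normThreshold < A ∧ ∀ (z : ℂ) (hz : L.normThreshold < z.im), A ≤ z.im → |z.re| ≤ R →
      ∀ (H' : HodgeStructure V k) (P' : H'.Polarization),
        (∀ q, H'.F q = ((L.F q).map (G z)).map (IsNilpotent.exp (z • L.N.baseChange ℂ))) → P'.form = L.Q → ∀ x : ℂ ⊗[ℚ] V,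
          1 / 2 * (L.nilpotentOrbitPolarization z (L.orbitThreshold_lt_im hz)).hodgeNorm x ≤ P'.hodgeNorm x ∧
            P'.hodgeNorm x ≤ 2 * (L.nilpotentOrbitPolarization z (L.orbitThreshold_lt_im hz)).hodgeNorm x := by
  obtain ⟨c, hc, D, hD, m, A, hA, h⟩ := L.exists_forall_hodgeNorm_periodMap_mem_Icc G hC hγ hG hGQ R
  obtain ⟨A₂, hA₂⟩ := exists_forall_pow_mul_exp_le'' hγ m (ε := 1 / (2 * (c * D + 1))) (by positivity)
  refine ⟨max A A₂, lt_of_lt_of_le hA (le_max_left _ _), fun z hz hAz hRz H' P' hF hform x => ?_⟩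
  obtain ⟨-, hx⟩ := h z hz ((le_max_left _ _).trans hAz) hRz
  obtain ⟨h1, h2⟩ := hx H' P' hF hform x
  have hz0 : 0 < z.im := L.im_pos_of_normThreshold_lt hz
  have hcη : c * (D * z.im ^ m * Real.exp (-γ * z.im)) ≤ 1 / 2 := by
    have hh := hA₂ z.im ((le_max_right _ _).trans hAz)
    have hq : 0 < c * D + 1 := by positivity
    calc c * (D * z.im ^ m * Real.exp (-γ * z.im)) = c * D * (z.im ^ m * Real.exp (-γ * z.im)) := by ring
      _ ≤ c * D * (1 / (2 * (c * D + 1))) := mul_le_mul_of_nonneg_left hh (by positivity)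
      _ = c * D / (c * D + 1) / 2 := by field_simp
      _ ≤ 1 / 2 := by have : c * D / (c * D + 1) ≤ 1 := (div_le_one hq).2 (by linarith); linarith
  have h0 := (L.nilpotentOrbitPolarization z (L.orbitThreshold_lt_im hz)).hodgeNorm_nonneg x
  constructor
  · nlinarith
  · nlinarith

/-! ## §2 «We may replace `Φ` by `Φ_nil`» (CDK 4.2, `d = 1`) -/

/-- **Transfer of the hypotheses of Thm. 2.16 from `Φ(z)` to the nilpotent orbit `θ(z)`**: there are `A` and `α' = min(α, γ)/2 > 0` such that
for `Im z ≥ A`, `|Re z| ≤ R`, every `(H', P')` on the flag `Φ(z)` with form `Q`, and every `v` with `‖v‖_{Φ(z)} ≤ K` and `f ∈ F^pΦ(z)`,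
`‖v − f‖_{Φ(z)} ≤ e^{−α Im z}‖v‖_{Φ(z)}`: **`‖v‖_{θ(z)} ≤ 2K` and some `f₀ ∈ F^pθ(z)` has `‖v − f₀‖_{θ(z)} ≤ e^{−α' Im z}‖v‖_{θ(z)}`** — «we still have
`u(n)` bounded in the `Φ′`-Hodge norm at `z(n)`, and `∼_{z(n)} Φ′⁰(z(n))` … we may replace `Φ` by `Φ′`» (`Φ′ = Φ_nil`; `f = g_z f₀`,
`‖g_z f₀ − f₀‖_{θ(z)} ≤ η‖f₀‖`, metrics comparable within `2`). [cite: CattaniDeligneKaplan1995, 4.2 (p. 500), 2.18 (p. 492), 2.16 Remark (ii)] -/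
theorem exists_forall_transfer_to_nilpotentOrbit (G : ℂ → Module.End ℂ (ℂ ⊗[ℚ] V)) {C γ A₀ : ℝ} (hC : 0 ≤ C) (hγ : 0 < γ)
    (hG : ∀ z : ℂ, A₀ ≤ z.im → ∀ w, L.referenceNorm (G z w - w) ≤ C * Real.exp (-γ * z.im) * L.referenceNorm w)
    (hGQ : ∀ z x y, L.Q.baseChange ℂ (G z x) (G z y) = L.Q.baseChange ℂ x y) (R K : ℝ) {α : ℝ} (hα : 0 < α) :
    ∃ A : ℝ, L.normThreshold < A ∧ ∀ (z : ℂ) (hz : L.normThreshold < z.im), A ≤ z.im → |z.re| ≤ R →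
      ∀ (H' : HodgeStructure V k) (P' : H'.Polarization),
        (∀ q, H'.F q = ((L.F q).map (G z)).map (IsNilpotent.exp (z • L.N.baseChange ℂ))) → P'.form = L.Q → ∀ (p : ℤ) (v : ℂ ⊗[ℚ] V),
          P'.hodgeNorm v ≤ K → (∃ f ∈ H'.F p, P'.hodgeNorm (v - f) ≤ Real.exp (-α * z.im) * P'.hodgeNorm v) →
            (L.nilpotentOrbitPolarization z (L.orbitThreshold_lt_im hz)).hodgeNorm v ≤ 2 * K ∧
              ∃ f₀ ∈ (L.nilpotentOrbit z (L.orbitThreshold_lt_im hz)).F p,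
                (L.nilpotentOrbitPolarization z (L.orbitThreshold_lt_im hz)).hodgeNorm (v - f₀) ≤
                  Real.exp (-(min α γ / 2) * z.im) * (L.nilpotentOrbitPolarization z (L.orbitThreshold_lt_im hz)).hodgeNorm v := by
  obtain ⟨A₁, hA₁, h2⟩ := L.exists_forall_hodgeNorm_periodMap_le_two_mul G hC hγ hG hGQ R
  obtain ⟨D, hD, m, hDm⟩ := L.exists_forall_hodgeNorm_conj_sub_le G hC hG R
  -- thresholds: `η ≤ 1/2`, `8 e^{−αy} ≤ ½ e^{−α'y}`, `2D y^m e^{−γy} ≤ ½ e^{−α'y}` with `α' = min α γ / 2`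
  have hα' : 0 < min α γ / 2 := by positivity
  have hα'α : min α γ / 2 < α := by have := min_le_left α γ; linarith
  have hα'γ : min α γ / 2 < γ := by have := min_le_right α γ; linarith
  obtain ⟨A₂, hA₂⟩ := exists_forall_pow_mul_exp_le'' hγ m (ε := 1 / (2 * (D + 1))) (by positivity)
  obtain ⟨A₃, hA₃⟩ := exists_forall_pow_mul_exp_le_mul_exp hα'α 0 (ε := 1 / 16) (by norm_num)
  obtain ⟨A₄, hA₄⟩ := exists_forall_pow_mul_exp_le_mul_exp hα'γ m (ε := 1 / (4 * (D + 1))) (by positivity)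
  refine ⟨max (max A₁ A₀) (max A₂ (max A₃ A₄)), lt_of_lt_of_le hA₁ ((le_max_left _ _).trans (le_max_left _ _)),
    fun z hz hAz hRz H' P' hF hform p v hK happ => ?_⟩
  have hA₁z : A₁ ≤ z.im := ((le_max_left _ _).trans (le_max_left _ _)).trans hAz
  have hA₀z : A₀ ≤ z.im := ((le_max_right _ _).trans (le_max_left _ _)).trans hAz
  have hA₂z : A₂ ≤ z.im := ((le_max_left _ _).trans (le_max_right _ _)).trans hAz
  have hA₃z : A₃ ≤ z.im := (((le_max_left _ _).trans (le_max_right _ _)).trans (le_max_right _ _)).trans hAz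
  have hA₄z : A₄ ≤ z.im := (((le_max_right _ _).trans (le_max_right _ _)).trans (le_max_right _ _)).trans hAz
  have hz0 : 0 < z.im := L.im_pos_of_normThreshold_lt hz
  set y := z.im with hy_def
  set Pz := L.nilpotentOrbitPolarization z (L.orbitThreshold_lt_im hz) with hPz_def
  set g := IsNilpotent.exp (z • L.N.baseChange ℂ) * G z * IsNilpotent.exp (-(z • L.N.baseChange ℂ)) with hg_def
  set η := D * y ^ m * Real.exp (-γ * y) with hη_def
  have hη0 : 0 ≤ η := by positivity
  have hη2 : η ≤ 1 / 2 := by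
    have h := hA₂ y hA₂z
    have hq : 0 < D + 1 := by positivity
    calc η = D * (y ^ m * Real.exp (-γ * y)) := by rw [hη_def]; ring
      _ ≤ D * (1 / (2 * (D + 1))) := mul_le_mul_of_nonneg_left h hD
      _ = D / (D + 1) / 2 := by field_simp
      _ ≤ 1 / 2 := by have : D / (D + 1) ≤ 1 := (div_le_one hq).2 (by linarith); linarith
  have hcmp := h2 z hz hA₁z hRz H' P' hF hform
  have hK0 : 0 ≤ K := (P'.hodgeNorm_nonneg v).trans hK
  -- the norm bound
  have hvθ : Pz.hodgeNorm v ≤ 2 * K := by have h := (hcmp v).1; linarith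
  refine ⟨hvθ, ?_⟩
  -- the closeness
  obtain ⟨f, hf, hfε⟩ := happ
  rw [hF p, L.map_exp_map_eq_map_conj_nilpotentOrbit_F G (L.orbitThreshold_lt_im hz) p] at hf
  obtain ⟨f₀, hf₀, rfl⟩ := hf
  refine ⟨f₀, hf₀, ?_⟩
  have h1 : Pz.hodgeNorm (g f₀ - f₀) ≤ η * Pz.hodgeNorm f₀ := hDm z hz hA₀z hRz f₀
  have h3 : Pz.hodgeNorm (v - g f₀) ≤ 2 * (Real.exp (-α * y) * (2 * Pz.hodgeNorm v)) := by
    have ha := (hcmp (v - g f₀)).1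
    have hb := (hcmp v).2
    have hc : P'.hodgeNorm (v - g f₀) ≤ Real.exp (-α * y) * (2 * Pz.hodgeNorm v) :=
      hfε.trans (mul_le_mul_of_nonneg_left hb (Real.exp_pos _).le)
    linarith
  -- `‖v − f₀‖ ≤ ‖v − g f₀‖ + ‖g f₀ − f₀‖ ≤ 4 e^{−αy}‖v‖ + η(‖v‖ + ‖v − f₀‖)`
  have h4 : Pz.hodgeNorm (v - f₀) ≤ Pz.hodgeNorm (v - g f₀) + Pz.hodgeNorm (g f₀ - f₀) := by
    have e : v - f₀ = (v - g f₀) + (g f₀ - f₀) := by abel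
    rw [e]; exact Pz.hodgeNorm_add_le _ _
  have h5 : Pz.hodgeNorm f₀ ≤ Pz.hodgeNorm v + Pz.hodgeNorm (v - f₀) := by
    have h := Pz.hodgeNorm_le_add_hodgeNorm_sub f₀ v
    rw [Pz.hodgeNorm_sub_rev f₀ v] at h
    exact h
  have h0v := Pz.hodgeNorm_nonneg v
  have h0d := Pz.hodgeNorm_nonneg (v - f₀)
  have h6 : Pz.hodgeNorm (v - f₀) ≤ 4 * Real.exp (-α * y) * Pz.hodgeNorm v + η * (Pz.hodgeNorm v + Pz.hodgeNorm (v - f₀)) := by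
    nlinarith [h1, h3, h4, h5, Real.exp_pos (-α * y)]
  have hηd : η * Pz.hodgeNorm (v - f₀) ≤ 1 / 2 * Pz.hodgeNorm (v - f₀) := mul_le_mul_of_nonneg_right hη2 h0d
  have h7 : Pz.hodgeNorm (v - f₀) ≤ (8 * Real.exp (-α * y) + 2 * η) * Pz.hodgeNorm v := by nlinarith
  -- `8 e^{−αy} + 2η ≤ e^{−α'y}`
  have h8 : 8 * Real.exp (-α * y) ≤ 1 / 2 * Real.exp (-(min α γ / 2) * y) := by
    have h := hA₃ y hA₃z
    rw [pow_zero, one_mul] at h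
    linarith
  have h9 : 2 * η ≤ 1 / 2 * Real.exp (-(min α γ / 2) * y) := by
    have h := hA₄ y hA₄z
    have hq : 0 < D + 1 := by positivity
    calc 2 * η = 2 * D * (y ^ m * Real.exp (-γ * y)) := by rw [hη_def]; ring
      _ ≤ 2 * D * (1 / (4 * (D + 1)) * Real.exp (-(min α γ / 2) * y)) := mul_le_mul_of_nonneg_left h (by positivity)
      _ = D / (D + 1) * (1 / 2 * Real.exp (-(min α γ / 2) * y)) := by field_simp; ring
      _ ≤ 1 * (1 / 2 * Real.exp (-(min α γ / 2) * y)) :=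
          mul_le_mul_of_nonneg_right ((div_le_one hq).2 (by linarith)) (by positivity)
      _ = 1 / 2 * Real.exp (-(min α γ / 2) * y) := one_mul _
  calc Pz.hodgeNorm (v - f₀) ≤ (8 * Real.exp (-α * y) + 2 * η) * Pz.hodgeNorm v := h7
    _ ≤ Real.exp (-(min α γ / 2) * y) * Pz.hodgeNorm v := mul_le_mul_of_nonneg_right (by linarith) h0v

/-! ## §3 Cattani–Deligne–Kaplan, Theorem 2.16, for the period map `Φ` (`r = 1`) -/

/-- **CDK THEOREM 2.16 FOR A ONE-VARIABLE PERIOD MAP IN ASYMPTOTIC NORMAL FORM.**  Let `L = (W, F, N, Q)` be a polarized limit mixed Hodge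
structure of weight `k = p + p` on the finite-dimensional `ℚ`-space `V` with nilpotent orbit `θ(z)`, `G : ℂ → End(V_ℂ)` with `|G(z)w − w|₀ ≤
C e^{−γ Im z}|w|₀` (`Im z ≥ A₀`, `γ > 0`) and `G(z) ∈ Aut(Q_ℂ)`, `Φ(z) = exp(zN)·G(z)·F` the period map, `Λ ⊆ V` finitely generated, `K`, `α > 0`,
`R` reals.  There is `A₁ > β` such that: for every `u ∈ Λ`, every `z` with `Im z ≥ A₁`, `|Re z| ≤ R`, and every polarized Hodge structure
`(H', P')` of weight `k` with Hodge filtration `Φ(z)` and form `Q` (the Hodge metric AT `Φ(z)`), if `‖1 ⊗ u‖_{Φ(z)} ≤ K` and some `f ∈ F^pΦ(z)` has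
`‖1 ⊗ u − f‖_{Φ(z)} ≤ e^{−α Im z}‖1 ⊗ u‖_{Φ(z)}` («`v ∼_z Φ⁰(z)` relative to the Hodge metric at `Φ(z)`»), then **(ii) `u ∈ W_k`; (4.1.4)
`N u = 0`; (iii) `1 ⊗ u ∈ F^p`, a limiting Hodge filtration, and `u ∈ H^{p,p}(θ(z'))` at every point of the nilpotent orbit; (i) the set of
such `u` is FINITE.** [cite: CattaniDeligneKaplan1995, Thm. 2.16 (p. 492), 2.18, 4.2 (p. 500), §4 (pp. 499–505)] [cite: Schmid1973, (4.12), Thm. (6.6) (cite only)] -/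
theorem exists_threshold_approximate_integral_hodgeClasses_periodMap {p : ℤ} (hpk : p + p = k)
    (G : ℂ → Module.End ℂ (ℂ ⊗[ℚ] V)) {C γ A₀ : ℝ} (hC : 0 ≤ C) (hγ : 0 < γ)
    (hG : ∀ z : ℂ, A₀ ≤ z.im → ∀ w, L.referenceNorm (G z w - w) ≤ C * Real.exp (-γ * z.im) * L.referenceNorm w)
    (hGQ : ∀ z x y, L.Q.baseChange ℂ (G z x) (G z y) = L.Q.baseChange ℂ x y) (Λ : Submodule ℤ V) (hΛ : Λ.FG) (K R : ℝ)
    {α : ℝ} (hα : 0 < α) :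
    ∃ A₁ : ℝ, L.normThreshold < A₁ ∧
      (∀ u ∈ Λ, ∀ (z : ℂ), L.normThreshold < z.im → A₁ ≤ z.im → |z.re| ≤ R →
        ∀ (H' : HodgeStructure V k) (P' : H'.Polarization),
          (∀ q, H'.F q = ((L.F q).map (G z)).map (IsNilpotent.exp (z • L.N.baseChange ℂ))) → P'.form = L.Q →
          P'.hodgeNorm (ofRat u) ≤ K → (∃ f ∈ H'.F p, P'.hodgeNorm (ofRat u - f) ≤ Real.exp (-α * z.im) * P'.hodgeNorm (ofRat u)) →
          u ∈ L.W k ∧ L.N u = 0 ∧ ofRat u ∈ L.F p ∧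
            ∀ (z' : ℂ) (hz' : L.orbitThreshold < z'.im), ofRat u ∈ (L.nilpotentOrbit z' hz').piece p p) ∧
      {u : V | u ∈ Λ ∧ ∃ (z : ℂ), L.normThreshold < z.im ∧ A₁ ≤ z.im ∧ |z.re| ≤ R ∧
        ∃ (H' : HodgeStructure V k) (P' : H'.Polarization),
          (∀ q, H'.F q = ((L.F q).map (G z)).map (IsNilpotent.exp (z • L.N.baseChange ℂ))) ∧ P'.form = L.Q ∧
          P'.hodgeNorm (ofRat u) ≤ K ∧
          ∃ f ∈ H'.F p, P'.hodgeNorm (ofRat u - f) ≤ Real.exp (-α * z.im) * P'.hodgeNorm (ofRat u)}.Finite := by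
  obtain ⟨A_t, hA_t, htr⟩ := L.exists_forall_transfer_to_nilpotentOrbit G hC hγ hG hGQ R K hα
  have hα' : 0 < min α γ / 2 := by positivity
  obtain ⟨A₂, hA₂, h216, hfin⟩ := L.exists_threshold_approximate_integral_hodgeClasses hpk Λ hΛ (2 * K) R hα'
  refine ⟨max A_t A₂, lt_of_lt_of_le hA_t (le_max_left _ _), fun u hu z hz hAz hRz H' P' hF hform hK happ => ?_, hfin.subset ?_⟩
  · obtain ⟨hnorm, happ'⟩ := htr z hz ((le_max_left _ _).trans hAz) hRz H' P' hF hform p (ofRat u) hK happ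
    exact h216 u hu z hz ((le_max_right _ _).trans hAz) hRz hnorm happ'
  · rintro u ⟨hu, z, hz, hAz, hRz, H', P', hF, hform, hK, happ⟩
    obtain ⟨hnorm, happ'⟩ := htr z hz ((le_max_left _ _).trans hAz) hRz H' P' hF hform p (ofRat u) hK happ
    exact ⟨hu, z, hz, (le_max_right _ _).trans hAz, hRz, hnorm, happ'⟩

end PolarizedLimitMixedHodgeStructure

end HodgeTheory

end Literature.AlgebraicGeometry

end
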